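import Literature.AlgebraicGeometry.Motives.AbelianVarietyPointCountIsogenyInvariance
import Literature.AlgebraicGeometry.Motives.AbelianVarietyGaloisCharpolyIsogenyRelations
import Literature.AlgebraicGeometry.Motives.AbelianVarietyMordellWeilRankIsogenyRelations
import Literature.AlgebraicGeometry.Motives.AbelianVarietyTwoSubgroupsIdempotentRelations
import HarnessLib

/-!
# Arithmetic of the Prym parts: `X ∼ Im u × Im(a − u)`, `B_H ∼ B_M × Im(N_H(|M| − N_M))` read on point counts,
# `ℓ`-adic characteristic polynomials of Galois and Frobenius, and Mordell–Weil ranks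

For a quasi-idempotent `u ≫ u = a • u` (`a ≠ 0`) of an abelian variety `X` over a perfect field the complementary pair of
abelian subvarieties `Im u`, `Im(a − u)` satisfies `Im u × Im(a − u) ∼ X` (the tree's `isIsogenous_image_biprod_image_sub`,
Poincaré's complete reducibility in Kani–Rosen form).  For a finite subgroup `H` acting through `ρ : G → End X` with norm
element `N_H = Σ_{h ∈ H} ρ(h)` (`N_H² = |H| N_H`) this is `X ∼ B_H × P_H` with the factor `B_H = Im N_H` and its **Prym part**
`P_H := Im(|H| − N_H)` (for `X = J_{C̃}`, `H ≤ Aut C̃`: `B_H ∼ J_{C̃/H}` and `P_H` is the Prym variety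
`P(C̃ → C̃/H) = Im(f^*)^c = Ker(Nm_f)^0` of Lange–Rodríguez §3.2.1 — the curve reading is not asserted here); for nested
`H ≤ M` the tree has `B_H ∼ B_M × Im(N_H(|M| − N_M))` ("`JC_H ∼ JC_N × P(C_H/C_N)`") and
`P_M ∼ P_H × Im(N_H(|M| − N_M))`, `X ∼ P_H × Im(N_H(|M| − N_M)) × B_M` (Cor. 3.2.14 for the tower `X → X/H → X/M`,
`Motives/AbelianVarietyTwoSubgroupsIdempotentRelations` §§4–6).

This file reads these isogenies through the three additive isogeny-invariant functors of the generation — point counts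
`N_m` over finite fields (`Motives/AbelianVarietyPointCountIsogenyInvariance`), `ℓ`-adic Tate modules with their Galois
and Frobenius characteristic polynomials (`Motives/AbelianVarietyGaloisCharpolyIsogenyRelations`) and Mordell–Weil groups
`⊗ ℚ` (`Motives/AbelianVarietyMordellWeilRankIsogenyRelations`):

* `N_m(X) = N_m(Im u) · N_m(Im(a − u))`, `N_m(X) = N_m(B_H) · N_m(P_H)`, `N_m(B_H) = N_m(B_M) · N_m(Im(N_H(|M| − N_M)))`
  (`m ≥ 1`; e.g. `#J_{C̃}(𝔽_q) = #J_C(𝔽_q) · #P(𝔽_q)` for a cover `C̃ → C`);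
* `charpoly(σ | T_ℓ X) = charpoly(σ | T_ℓ Im u) · charpoly(σ | T_ℓ Im(a − u))` for every `σ ∈ Gal(K̄/K)` and the trace
  form `Tr(σ | T_ℓ P_H) = Tr(σ | T_ℓ X) − Tr(σ | T_ℓ B_H)`; over a finite field `P_X = P_{B_H} · P_{P_H}` for Milne's
  characteristic polynomials of Frobenius (the `ℓ`-adic shape of `L(C̃, s) = L(C, s) · L(P, s)`);
* `rk X(L) = rk Im u(L) + rk Im(a − u)(L)`, `rk B_H(L) = rk B_M(L) + rk Im(N_H(|M| − N_M))(L)` (finite-rank hypotheses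
  explicit, as in the Mordell–Weil file).

## Main statements (sorry-free; theorems only, no new definitions)

* §1 complementary pair: `pointCount_eq_mul_of_comp_self_eq_nsmul`, `charpoly_tateRep_eq_mul_of_comp_self_eq_nsmul`,
  `trace_tateRep_eq_add_of_comp_self_eq_nsmul`, `charpoly_frobenius_eq_mul_of_comp_self_eq_nsmul`,
  `finrank_points_eq_add_of_comp_self_eq_nsmul`.
* §2 `X ∼ B_H × P_H`: `pointCount_eq_pointCount_image_norm_mul`, `charpoly_tateRep_eq_charpoly_image_norm_mul`,
  `trace_tateRep_image_sub_norm_eq`, `charpoly_frobenius_eq_charpoly_image_norm_mul`, `finrank_points_eq_finrank_points_image_norm_add`.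
* §3 nested `H ≤ M` and the whole group: `pointCount_image_norm_eq_mul_of_le`, `charpoly_tateRep_image_norm_eq_mul_of_le`,
  `finrank_points_image_norm_eq_add_of_le`, `pointCount_image_sub_norm_eq_mul_of_le` (`N_m(P_M) = N_m(P_H) · N_m(Im N_H(|M|−N_M))`),
  `pointCount_image_norm_eq_mul_normG`, `charpoly_tateRep_image_norm_eq_mul_normG`.

Scope (stated, not hidden).  Perfect base field for the isogenies (finite in the point-count / Frobenius statements); `ℓ`
invertible in `K`; `P_H = Im(|H| − N_H)` by definition here (no polarisations, no `Ker(Nm)^0`); no `L`-functions or curves.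

## References

* [LangeRodriguez2022] H. Lange, R. E. Rodríguez, *Decomposition of Jacobians by Prym Varieties*, LNM 2310 (2022),
  §3.2.1 (PDF p. 56: `P(f) := Im(f^*)^c`, (3.5) `P(f) = Ker(Nm_f)^0`), §3.2 Cor. 3.2.14 (PDF p. 60), §3.5 Cor. 3.5.9 (PDF p. 70).
* [Lange2023AbelianVarietiesComplex] H. Lange, *Abelian Varieties over the Complex Numbers* (2023), §2.4.4 Cor. 2.4.24
  (complementary abelian subvarieties).
* [KaniRosen1989] E. Kani, M. Rosen, *Idempotent relations and factors of Jacobians*, Math. Ann. 284 (1989), Thm. A.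
* [Tate1966Endomorphisms] J. Tate, *Endomorphisms of abelian varieties over finite fields* (1966), §1 Thm. 1.
* [Milne1986AbelianVarieties] J. S. Milne, *Abelian varieties* (1986), §19 Thm. 19.1 and its proof (pp. 143–145).
* [MumfordAV1970] D. Mumford, *Abelian Varieties* (1970), §19 (pp. 169, 172, 176).
* [DokchitserEtAl2022] V. Dokchitser, H. Green, A. Konstantinou, A. Morgan, *Parity of ranks of Jacobians of curves* (2022), §3.
-/

noncomputable section

open CategoryTheory CategoryTheory.Limits
open scoped TensorProduct
open Literature.NumberTheory.DiophantineGeometry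

universe u

namespace Literature.AlgebraicGeometry.Motives

namespace AbelianVariety

/-! ## §1 A complementary pair `Im u`, `Im(a − u)` -/

section Complement

variable {K : Type u} [Field K] {X : AbelianVariety K} {u : X ⟶ X} {a : ℕ}

/-- **`N_m(X) = N_m(Im u) · N_m(Im(a − u))`** over a finite field, for a quasi-idempotent `u ≫ u = a • u`, `a ≠ 0`, and
`m ≥ 1` (`Im u × Im(a − u) ∼ X` and `N_m` is multiplicative and an isogeny invariant). [cite: Lange2023AbelianVarietiesComplex, §2.4.4 Cor. 2.4.24 (PDF p. 123)]
[cite: Tate1966Endomorphisms, §1 Thm. 1] [cite: Milne1986AbelianVarieties, §19, proof of Thm. 19.1 (p. 145)] -/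
theorem pointCount_eq_mul_of_comp_self_eq_nsmul [Finite K] (hu : u ≫ u = a • u) (ha : a ≠ 0) {m : ℕ} (hm : 0 < m) :
    pointCount X.X m = pointCount (image u).X m * pointCount (image (a • 𝟙 X - u)).X m := by
  haveI : PerfectField K := PerfectField.ofFinite
  rw [← (isIsogenous_image_biprod_image_sub hu ha).pointCount_eq hm, pointCount_biprod _ _ hm]

variable [PerfectField K] (ℓ : ℕ) [Fact ℓ.Prime]

/-- **`charpoly(σ | T_ℓ X) = charpoly(σ | T_ℓ Im u) · charpoly(σ | T_ℓ Im(a − u))`** in `ℤ_ℓ[X]` for every `σ ∈ Gal(K̄/K)`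
(`u² = a u`, `a ≠ 0`, perfect field, `ℓ` invertible in `K`; the instances on the Tate modules are the tree's theorems).
[cite: Lange2023AbelianVarietiesComplex, §2.4.4 Cor. 2.4.24 (PDF p. 123)] [cite: Tate1966Endomorphisms, §1] [cite: MumfordAV1970, §19 p. 176] -/
theorem charpoly_tateRep_eq_mul_of_comp_self_eq_nsmul (hu : u ≫ u = a • u) (ha : a ≠ 0) (hℓ : (ℓ : K) ≠ 0)
    (σ : Field.absoluteGaloisGroup K) :
    haveI := X.module_free_tateModule_holds ℓ hℓ
    haveI := module_finite_tateModule_of_cast_ne_zero X ℓ hℓ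
    haveI := (image u).module_free_tateModule_holds ℓ hℓ
    haveI := module_finite_tateModule_of_cast_ne_zero (image u) ℓ hℓ
    haveI := (image (a • 𝟙 X - u)).module_free_tateModule_holds ℓ hℓ
    haveI := module_finite_tateModule_of_cast_ne_zero (image (a • 𝟙 X - u)) ℓ hℓ
    (X.tateRep ℓ σ).charpoly = ((image u).tateRep ℓ σ).charpoly * ((image (a • 𝟙 X - u)).tateRep ℓ σ).charpoly := by
  haveI := X.module_free_tateModule_holds ℓ hℓ
  haveI := module_finite_tateModule_of_cast_ne_zero X ℓ hℓ
  haveI := (image u).module_free_tateModule_holds ℓ hℓ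
  haveI := module_finite_tateModule_of_cast_ne_zero (image u) ℓ hℓ
  haveI := (image (a • 𝟙 X - u)).module_free_tateModule_holds ℓ hℓ
  haveI := module_finite_tateModule_of_cast_ne_zero (image (a • 𝟙 X - u)) ℓ hℓ
  haveI := (image u ⊞ image (a • 𝟙 X - u)).module_free_tateModule_holds ℓ hℓ
  haveI := module_finite_tateModule_of_cast_ne_zero (image u ⊞ image (a • 𝟙 X - u)) ℓ hℓ
  rw [← (isIsogenous_image_biprod_image_sub hu ha).charpoly_tateRep_eq' hℓ σ]
  exact charpoly_tateRep_biprod_of_natCast_ne_zero ℓ _ _ hℓ σ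

/-- **`Tr(σ | T_ℓ X) = Tr(σ | T_ℓ Im u) + Tr(σ | T_ℓ Im(a − u))`** (same hypotheses). [cite: Lange2023AbelianVarietiesComplex, §2.4.4 Cor. 2.4.24 (PDF p. 123)]
[cite: Tate1966Endomorphisms, §1] [cite: MumfordAV1970, §19 Thm. 4 (p. 180)] -/
theorem trace_tateRep_eq_add_of_comp_self_eq_nsmul (hu : u ≫ u = a • u) (ha : a ≠ 0) (hℓ : (ℓ : K) ≠ 0)
    (σ : Field.absoluteGaloisGroup K) :
    LinearMap.trace ℤ_[ℓ] _ (X.tateRep ℓ σ) =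
      LinearMap.trace ℤ_[ℓ] _ ((image u).tateRep ℓ σ) + LinearMap.trace ℤ_[ℓ] _ ((image (a • 𝟙 X - u)).tateRep ℓ σ) := by
  haveI := X.module_free_tateModule_holds ℓ hℓ
  haveI := module_finite_tateModule_of_cast_ne_zero X ℓ hℓ
  haveI := (image u).module_free_tateModule_holds ℓ hℓ
  haveI := module_finite_tateModule_of_cast_ne_zero (image u) ℓ hℓ
  haveI := (image (a • 𝟙 X - u)).module_free_tateModule_holds ℓ hℓ
  haveI := module_finite_tateModule_of_cast_ne_zero (image (a • 𝟙 X - u)) ℓ hℓ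
  rw [trace_eq_neg_nextCoeff_charpoly, trace_eq_neg_nextCoeff_charpoly, trace_eq_neg_nextCoeff_charpoly,
    charpoly_tateRep_eq_mul_of_comp_self_eq_nsmul ℓ hu ha hℓ σ,
    Polynomial.Monic.nextCoeff_mul (LinearMap.charpoly_monic _) (LinearMap.charpoly_monic _), neg_add]

omit [PerfectField K] in
/-- **`P_X = P_{Im u} · P_{Im(a − u)}`** for Milne's characteristic polynomials of Frobenius over a finite field (`ℓ ∤ q`).
[cite: Milne1986AbelianVarieties, §19 Thm. 19.1 and its proof (pp. 144–145)] [cite: Tate1966Endomorphisms, §1 Thm. 1] -/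
theorem charpoly_frobenius_eq_mul_of_comp_self_eq_nsmul [Finite K] (hu : u ≫ u = a • u) (ha : a ≠ 0) (hℓ : (ℓ : K) ≠ 0) :
    haveI := X.module_free_tateModule_holds ℓ hℓ
    haveI := module_finite_tateModule_of_cast_ne_zero X ℓ hℓ
    haveI := (image u).module_free_tateModule_holds ℓ hℓ
    haveI := module_finite_tateModule_of_cast_ne_zero (image u) ℓ hℓ
    haveI := (image (a • 𝟙 X - u)).module_free_tateModule_holds ℓ hℓ
    haveI := module_finite_tateModule_of_cast_ne_zero (image (a • 𝟙 X - u)) ℓ hℓ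
    (tateModuleMap ℓ (frobeniusHom X)).charpoly =
      (tateModuleMap ℓ (frobeniusHom (image u))).charpoly * (tateModuleMap ℓ (frobeniusHom (image (a • 𝟙 X - u)))).charpoly := by
  haveI : PerfectField K := PerfectField.ofFinite
  haveI := X.module_free_tateModule_holds ℓ hℓ
  haveI := module_finite_tateModule_of_cast_ne_zero X ℓ hℓ
  haveI := (image u).module_free_tateModule_holds ℓ hℓ
  haveI := module_finite_tateModule_of_cast_ne_zero (image u) ℓ hℓ
  haveI := (image (a • 𝟙 X - u)).module_free_tateModule_holds ℓ hℓ
  haveI := module_finite_tateModule_of_cast_ne_zero (image (a • 𝟙 X - u)) ℓ hℓ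
  simp only [charpoly_tateModuleMap_frobeniusHom_eq_charpoly_tateRep]
  exact charpoly_tateRep_eq_mul_of_comp_self_eq_nsmul ℓ hu ha hℓ (arithFrob K)

omit [Fact ℓ.Prime] in
/-- **`rk X(L) = rk Im u(L) + rk Im(a − u)(L)`** for the Mordell–Weil groups over any extension `L/K`, when the two
parts have finite rank (then so does `X(L) ⊗ ℚ`). [cite: Lange2023AbelianVarietiesComplex, §2.4.4 Cor. 2.4.24 (PDF p. 123)]
[cite: MumfordAV1970, §19 Remark p. 169] [cite: DokchitserEtAl2022, §3 (additive functor lemma)] -/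
theorem finrank_points_eq_add_of_comp_self_eq_nsmul (hu : u ≫ u = a • u) (ha : a ≠ 0) (L : Type u) [Field L] [Algebra K L]
    [Module.Finite ℚ (ℚ ⊗[ℤ] Additive ((image u).Points L))]
    [Module.Finite ℚ (ℚ ⊗[ℤ] Additive ((image (a • 𝟙 X - u)).Points L))] :
    Module.finrank ℚ (ℚ ⊗[ℤ] Additive (X.Points L)) =
      Module.finrank ℚ (ℚ ⊗[ℤ] Additive ((image u).Points L)) +
        Module.finrank ℚ (ℚ ⊗[ℤ] Additive ((image (a • 𝟙 X - u)).Points L)) := by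
  rw [← (isIsogenous_image_biprod_image_sub hu ha).finrank_points_eq L, finrank_points_biprod]

end Complement

/-! ## §2 `X ∼ B_H × P_H`: the Kani–Rosen factor `B_H = Im N_H` and its Prym part `P_H = Im(|H| − N_H)` -/

section Prym

variable {K : Type u} [Field K] {X : AbelianVariety K} {G : Type} [Group G] (ρ : G →* End X) {H : Subgroup G}
  [Fintype H] {N : X ⟶ X}

/-- **`N_m(X) = N_m(B_H) · N_m(P_H)`** over a finite field (`m ≥ 1`; `#J_{C̃}(𝔽_{q^m}) = #J_{C̃/H}(𝔽_{q^m}) · #P(𝔽_{q^m})`-shape).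
[cite: LangeRodriguez2022, §3.2.1 (PDF p. 56)] [cite: Tate1966Endomorphisms, §1 Thm. 1] [cite: Milne1986AbelianVarieties, §19, proof of Thm. 19.1 (p. 145)] -/
theorem pointCount_eq_pointCount_image_norm_mul [Finite K] (hN : End.of N = ∑ h : H, ρ h) {m : ℕ} (hm : 0 < m) :
    pointCount X.X m = pointCount (image N).X m * pointCount (image (Fintype.card H • 𝟙 X - N)).X m :=
  pointCount_eq_mul_of_comp_self_eq_nsmul (norm_comp_norm_eq_card_nsmul ρ hN) Fintype.card_ne_zero hm

variable [PerfectField K] (ℓ : ℕ) [Fact ℓ.Prime]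

/-- **`charpoly(σ | T_ℓ X) = charpoly(σ | T_ℓ B_H) · charpoly(σ | T_ℓ P_H)`** for every `σ ∈ Gal(K̄/K)` (perfect field,
`ℓ` invertible in `K`). [cite: LangeRodriguez2022, §3.2.1 (PDF p. 56)] [cite: Tate1966Endomorphisms, §1] [cite: DokchitserEtAl2022, §3 (additive functor lemma)] -/
theorem charpoly_tateRep_eq_charpoly_image_norm_mul (hN : End.of N = ∑ h : H, ρ h) (hℓ : (ℓ : K) ≠ 0)
    (σ : Field.absoluteGaloisGroup K) :
    haveI := X.module_free_tateModule_holds ℓ hℓ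
    haveI := module_finite_tateModule_of_cast_ne_zero X ℓ hℓ
    haveI := (image N).module_free_tateModule_holds ℓ hℓ
    haveI := module_finite_tateModule_of_cast_ne_zero (image N) ℓ hℓ
    haveI := (image (Fintype.card H • 𝟙 X - N)).module_free_tateModule_holds ℓ hℓ
    haveI := module_finite_tateModule_of_cast_ne_zero (image (Fintype.card H • 𝟙 X - N)) ℓ hℓ
    (X.tateRep ℓ σ).charpoly =
      ((image N).tateRep ℓ σ).charpoly * ((image (Fintype.card H • 𝟙 X - N)).tateRep ℓ σ).charpoly :=
  charpoly_tateRep_eq_mul_of_comp_self_eq_nsmul ℓ (norm_comp_norm_eq_card_nsmul ρ hN) Fintype.card_ne_zero hℓ σ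

/-- **`Tr(σ | T_ℓ P_H) = Tr(σ | T_ℓ X) − Tr(σ | T_ℓ B_H)`**: the Galois character of the Prym part.
[cite: LangeRodriguez2022, §3.2.1 (PDF p. 56)] [cite: Tate1966Endomorphisms, §1] [cite: MumfordAV1970, §19 Thm. 4 (p. 180)] -/
theorem trace_tateRep_image_sub_norm_eq (hN : End.of N = ∑ h : H, ρ h) (hℓ : (ℓ : K) ≠ 0) (σ : Field.absoluteGaloisGroup K) :
    LinearMap.trace ℤ_[ℓ] _ ((image (Fintype.card H • 𝟙 X - N)).tateRep ℓ σ) =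
      LinearMap.trace ℤ_[ℓ] _ (X.tateRep ℓ σ) - LinearMap.trace ℤ_[ℓ] _ ((image N).tateRep ℓ σ) := by
  rw [trace_tateRep_eq_add_of_comp_self_eq_nsmul ℓ (norm_comp_norm_eq_card_nsmul ρ hN) Fintype.card_ne_zero hℓ σ,
    add_sub_cancel_left]

omit [PerfectField K] in
/-- **`P_X = P_{B_H} · P_{P_H}`** for the characteristic polynomials of Frobenius over a finite field (`ℓ ∤ q`) — the `ℓ`-adic
shape of `Z`/`L`-function factorisations `L(C̃, s) = L(C̃/H, s) · L(P, s)` (not asserted). [cite: Milne1986AbelianVarieties, §19 Thm. 19.1 and its proof (pp. 144–145)]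
[cite: LangeRodriguez2022, §3.2.1 (PDF p. 56)] -/
theorem charpoly_frobenius_eq_charpoly_image_norm_mul [Finite K] (hN : End.of N = ∑ h : H, ρ h) (hℓ : (ℓ : K) ≠ 0) :
    haveI := X.module_free_tateModule_holds ℓ hℓ
    haveI := module_finite_tateModule_of_cast_ne_zero X ℓ hℓ
    haveI := (image N).module_free_tateModule_holds ℓ hℓ
    haveI := module_finite_tateModule_of_cast_ne_zero (image N) ℓ hℓ
    haveI := (image (Fintype.card H • 𝟙 X - N)).module_free_tateModule_holds ℓ hℓ
    haveI := module_finite_tateModule_of_cast_ne_zero (image (Fintype.card H • 𝟙 X - N)) ℓ hℓ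
    (tateModuleMap ℓ (frobeniusHom X)).charpoly =
      (tateModuleMap ℓ (frobeniusHom (image N))).charpoly *
        (tateModuleMap ℓ (frobeniusHom (image (Fintype.card H • 𝟙 X - N)))).charpoly :=
  charpoly_frobenius_eq_mul_of_comp_self_eq_nsmul ℓ (norm_comp_norm_eq_card_nsmul ρ hN) Fintype.card_ne_zero hℓ

omit [Fact ℓ.Prime] in
/-- **`rk X(L) = rk B_H(L) + rk P_H(L)`** (Mordell–Weil ranks, finite-rank hypotheses explicit).
[cite: LangeRodriguez2022, §3.2.1 (PDF p. 56)] [cite: MumfordAV1970, §19 Remark p. 169] [cite: DokchitserEtAl2022, §3 (additive functor lemma)] -/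
theorem finrank_points_eq_finrank_points_image_norm_add (hN : End.of N = ∑ h : H, ρ h) (L : Type u) [Field L]
    [Algebra K L] [Module.Finite ℚ (ℚ ⊗[ℤ] Additive ((image N).Points L))]
    [Module.Finite ℚ (ℚ ⊗[ℤ] Additive ((image (Fintype.card H • 𝟙 X - N)).Points L))] :
    Module.finrank ℚ (ℚ ⊗[ℤ] Additive (X.Points L)) =
      Module.finrank ℚ (ℚ ⊗[ℤ] Additive ((image N).Points L)) +
        Module.finrank ℚ (ℚ ⊗[ℤ] Additive ((image (Fintype.card H • 𝟙 X - N)).Points L)) :=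
  finrank_points_eq_add_of_comp_self_eq_nsmul (norm_comp_norm_eq_card_nsmul ρ hN) Fintype.card_ne_zero L

end Prym

/-! ## §3 Nested subgroups `H ≤ M` and the whole group: `B_H ∼ B_M × Im(N_H(|M| − N_M))`, `P_M ∼ P_H × Im(N_H(|M| − N_M))` -/

section Nested

variable {K : Type u} [Field K] {X : AbelianVariety K} {G : Type} [Group G] (ρ : G →* End X) {H M : Subgroup G}
  [Fintype H] [Fintype M] {NH NM NG : X ⟶ X}

/-- **`N_m(B_H) = N_m(B_M) · N_m(Im(N_H(|M| − N_M)))` for `H ≤ M`** over a finite field (`m ≥ 1`) —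
"`JC_H ∼ JC_N × P(C_H/C_N)`" counted. [cite: LangeRodriguez2022, §3.5 Cor. 3.5.9 (PDF p. 70)] [cite: Tate1966Endomorphisms, §1 Thm. 1] -/
theorem pointCount_image_norm_eq_mul_of_le [Finite K] (hHM : H ≤ M) (hNH : End.of NH = ∑ h : H, ρ h)
    (hNM : End.of NM = ∑ m : M, ρ m) {m : ℕ} (hm : 0 < m) :
    pointCount (image NH).X m =
      pointCount (image NM).X m * pointCount (image (NH ≫ (Fintype.card M • 𝟙 X - NM))).X m := by
  haveI : PerfectField K := PerfectField.ofFinite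
  rw [(isIsogenous_image_norm_biprod_of_le ρ hHM hNH hNM).pointCount_eq hm, pointCount_biprod _ _ hm]

/-- **`N_m(P_M) = N_m(P_H) · N_m(Im(N_H(|M| − N_M)))` for `H ≤ M`** over a finite field (`m ≥ 1`) — "`P(f) ∼ P(k) × k^*P(h)`"
counted. [cite: LangeRodriguez2022, §3.2 Cor. 3.2.14 (a) (PDF p. 60)] [cite: Tate1966Endomorphisms, §1 Thm. 1] -/
theorem pointCount_image_sub_norm_eq_mul_of_le [Finite K] (hHM : H ≤ M) (hNH : End.of NH = ∑ h : H, ρ h)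
    (hNM : End.of NM = ∑ m : M, ρ m) {m : ℕ} (hm : 0 < m) :
    pointCount (image (Fintype.card M • 𝟙 X - NM)).X m =
      pointCount (image (Fintype.card H • 𝟙 X - NH)).X m *
        pointCount (image (NH ≫ (Fintype.card M • 𝟙 X - NM))).X m := by
  haveI : PerfectField K := PerfectField.ofFinite
  rw [(isIsogenous_image_sub_norm_biprod_of_le ρ hHM hNH hNM).pointCount_eq hm, pointCount_biprod _ _ hm]

/-- **`N_m(B_H) = N_m(B_G) · N_m(Im(N_H(|G| − N_G)))`** for the whole finite group `G` (finite field, `m ≥ 1`).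
[cite: LangeRodriguez2022, §3.5 Cor. 3.5.9 (PDF p. 70)] [cite: Tate1966Endomorphisms, §1 Thm. 1] -/
theorem pointCount_image_norm_eq_mul_normG [Finite K] [Fintype G] (hNH : End.of NH = ∑ h : H, ρ h)
    (hNG : End.of NG = ∑ g, ρ g) {m : ℕ} (hm : 0 < m) :
    pointCount (image NH).X m =
      pointCount (image NG).X m * pointCount (image (NH ≫ (Fintype.card G • 𝟙 X - NG))).X m := by
  haveI : PerfectField K := PerfectField.ofFinite
  rw [(isIsogenous_image_norm_biprod_normG ρ hNH hNG).pointCount_eq hm, pointCount_biprod _ _ hm]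

variable [PerfectField K] (ℓ : ℕ) [Fact ℓ.Prime]

/-- **`charpoly(σ | T_ℓ B_H) = charpoly(σ | T_ℓ B_M) · charpoly(σ | T_ℓ Im(N_H(|M| − N_M)))` for `H ≤ M`** (perfect field,
`ℓ` invertible in `K`, every `σ ∈ Γ_K`). [cite: LangeRodriguez2022, §3.5 Cor. 3.5.9 (PDF p. 70)] [cite: Tate1966Endomorphisms, §1]
[cite: DokchitserEtAl2022, §3 (additive functor lemma)] -/
theorem charpoly_tateRep_image_norm_eq_mul_of_le (hHM : H ≤ M) (hNH : End.of NH = ∑ h : H, ρ h)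
    (hNM : End.of NM = ∑ m : M, ρ m) (hℓ : (ℓ : K) ≠ 0) (σ : Field.absoluteGaloisGroup K) :
    haveI := (image NH).module_free_tateModule_holds ℓ hℓ
    haveI := module_finite_tateModule_of_cast_ne_zero (image NH) ℓ hℓ
    haveI := (image NM).module_free_tateModule_holds ℓ hℓ
    haveI := module_finite_tateModule_of_cast_ne_zero (image NM) ℓ hℓ
    haveI := (image (NH ≫ (Fintype.card M • 𝟙 X - NM))).module_free_tateModule_holds ℓ hℓ
    haveI := module_finite_tateModule_of_cast_ne_zero (image (NH ≫ (Fintype.card M • 𝟙 X - NM))) ℓ hℓ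
    ((image NH).tateRep ℓ σ).charpoly =
      ((image NM).tateRep ℓ σ).charpoly * ((image (NH ≫ (Fintype.card M • 𝟙 X - NM))).tateRep ℓ σ).charpoly := by
  haveI := (image NH).module_free_tateModule_holds ℓ hℓ
  haveI := module_finite_tateModule_of_cast_ne_zero (image NH) ℓ hℓ
  haveI := (image NM).module_free_tateModule_holds ℓ hℓ
  haveI := module_finite_tateModule_of_cast_ne_zero (image NM) ℓ hℓ
  haveI := (image (NH ≫ (Fintype.card M • 𝟙 X - NM))).module_free_tateModule_holds ℓ hℓ
  haveI := module_finite_tateModule_of_cast_ne_zero (image (NH ≫ (Fintype.card M • 𝟙 X - NM))) ℓ hℓ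
  haveI := (image NM ⊞ image (NH ≫ (Fintype.card M • 𝟙 X - NM))).module_free_tateModule_holds ℓ hℓ
  haveI := module_finite_tateModule_of_cast_ne_zero (image NM ⊞ image (NH ≫ (Fintype.card M • 𝟙 X - NM))) ℓ hℓ
  rw [(isIsogenous_image_norm_biprod_of_le ρ hHM hNH hNM).charpoly_tateRep_eq' hℓ σ]
  exact charpoly_tateRep_biprod_of_natCast_ne_zero ℓ _ _ hℓ σ

/-- The whole-group form: `charpoly(σ | T_ℓ B_H) = charpoly(σ | T_ℓ B_G) · charpoly(σ | T_ℓ Im(N_H(|G| − N_G)))`.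
[cite: LangeRodriguez2022, §3.5 Cor. 3.5.9 (PDF p. 70)] [cite: Tate1966Endomorphisms, §1] -/
theorem charpoly_tateRep_image_norm_eq_mul_normG [Fintype G] (hNH : End.of NH = ∑ h : H, ρ h)
    (hNG : End.of NG = ∑ g, ρ g) (hℓ : (ℓ : K) ≠ 0) (σ : Field.absoluteGaloisGroup K) :
    haveI := (image NH).module_free_tateModule_holds ℓ hℓ
    haveI := module_finite_tateModule_of_cast_ne_zero (image NH) ℓ hℓ
    haveI := (image NG).module_free_tateModule_holds ℓ hℓ
    haveI := module_finite_tateModule_of_cast_ne_zero (image NG) ℓ hℓ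
    haveI := (image (NH ≫ (Fintype.card G • 𝟙 X - NG))).module_free_tateModule_holds ℓ hℓ
    haveI := module_finite_tateModule_of_cast_ne_zero (image (NH ≫ (Fintype.card G • 𝟙 X - NG))) ℓ hℓ
    ((image NH).tateRep ℓ σ).charpoly =
      ((image NG).tateRep ℓ σ).charpoly * ((image (NH ≫ (Fintype.card G • 𝟙 X - NG))).tateRep ℓ σ).charpoly := by
  haveI := (image NH).module_free_tateModule_holds ℓ hℓ
  haveI := module_finite_tateModule_of_cast_ne_zero (image NH) ℓ hℓ
  haveI := (image NG).module_free_tateModule_holds ℓ hℓ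
  haveI := module_finite_tateModule_of_cast_ne_zero (image NG) ℓ hℓ
  haveI := (image (NH ≫ (Fintype.card G • 𝟙 X - NG))).module_free_tateModule_holds ℓ hℓ
  haveI := module_finite_tateModule_of_cast_ne_zero (image (NH ≫ (Fintype.card G • 𝟙 X - NG))) ℓ hℓ
  haveI := (image NG ⊞ image (NH ≫ (Fintype.card G • 𝟙 X - NG))).module_free_tateModule_holds ℓ hℓ
  haveI := module_finite_tateModule_of_cast_ne_zero (image NG ⊞ image (NH ≫ (Fintype.card G • 𝟙 X - NG))) ℓ hℓ
  rw [(isIsogenous_image_norm_biprod_normG ρ hNH hNG).charpoly_tateRep_eq' hℓ σ]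
  exact charpoly_tateRep_biprod_of_natCast_ne_zero ℓ _ _ hℓ σ

omit [Fact ℓ.Prime] in
/-- **`rk B_H(L) = rk B_M(L) + rk Im(N_H(|M| − N_M))(L)` for `H ≤ M`** (Mordell–Weil ranks; "`rk J_{C_H}(L) =
rk J_{C_N}(L) + rk P(C_H/C_N)(L)`"-shape). [cite: LangeRodriguez2022, §3.5 Cor. 3.5.9 (PDF p. 70)] [cite: MumfordAV1970, §19 Remark p. 169]
[cite: DokchitserEtAl2022, §3 (additive functor lemma)] -/
theorem finrank_points_image_norm_eq_add_of_le (hHM : H ≤ M) (hNH : End.of NH = ∑ h : H, ρ h)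
    (hNM : End.of NM = ∑ m : M, ρ m) (L : Type u) [Field L] [Algebra K L]
    [Module.Finite ℚ (ℚ ⊗[ℤ] Additive ((image NM).Points L))]
    [Module.Finite ℚ (ℚ ⊗[ℤ] Additive ((image (NH ≫ (Fintype.card M • 𝟙 X - NM))).Points L))] :
    Module.finrank ℚ (ℚ ⊗[ℤ] Additive ((image NH).Points L)) =
      Module.finrank ℚ (ℚ ⊗[ℤ] Additive ((image NM).Points L)) +
        Module.finrank ℚ (ℚ ⊗[ℤ] Additive ((image (NH ≫ (Fintype.card M • 𝟙 X - NM))).Points L)) := by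
  rw [(isIsogenous_image_norm_biprod_of_le ρ hHM hNH hNM).finrank_points_eq L, finrank_points_biprod]

end Nested

end AbelianVariety

end Literature.AlgebraicGeometry.Motives
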